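import Summits.CriticalPhenomena.PercolationContinuityZ3.Theorems.PercNearOneGluingAdditiveGluingGluedPairReduction
import Summits.CriticalPhenomena.PercolationContinuityZ3.Theorems.PercNearOneGluingAdditiveGluingThreeRelaysTie
import Summits.CriticalPhenomena.PercolationContinuityZ3.Theorems.PercNearOneGluingAdditiveGluingKnThm1Set
import HarnessLib

/-! # Crux `PercNearOneGluing.AdditiveGluing` (stmt-CriticalPhenomena-4576): three relays on the tie locus from the
# glued-pair exchange (T-d) — including the degenerate case

Support file (`--supports stmt-CriticalPhenomena-4576`, lead prim-png-lead-4576).  No definitions, no named facts, no sorries.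

With `W = {a₁,a₃}` the tied worst pair, `N₂ = {a₂↮a₁}∩{a₂↮a₃}`, `O_W = {o↔a₁}∪{o↔a₃}`, `O₂ = {o↔a₂}`:
* nondegenerate case `μ(N₂∩O₂) > 0`: the landed reduction `additiveGluing_threeRelays_eform_of_gluedPairExchange`
  ((T-d) ⟹ E-form, via the weighted glued-pair Theorem 1 and the identities Eq-α/Eq-β);
* degenerate case `μ(N₂∩O₂) = 0`: then `{o↔A} = O_W` a.s. (`O₂ ∖ O_W = N₂ ∩ O₂`), and the claim is the TWO-relay E-form for
  `{a₁,a₃}`, which is Kozma–Nitzan's Theorem 1 with observer `o` (`stub_knThm1Set` with `S = {o}`, landed):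
  `μ(O_W ∖ o↔b) ≤ max(μ(a₁↮b), μ(a₃↮b)) = μ(a₃↮b)` at the tie.
Result: `additiveGluing_threeRelays_of_gluedPairExchange` — the three-relay tie-locus E-form `μ(o↔A ∖ o↔b) ≤ t` from the
registered stub `stub_gluedPairExchangeTie_pl` alone (same shape as `additiveGluing_threeRelays_of_tieRegionCert`, which takes the
T1-tie certificate instead).  [cite: KozmaNitzan2024, Theorem 1 (§3.1), Theorem 2 (§3.2)]
-/

namespace Summit.CriticalPhenomena.PercolationContinuityZ3.Theorems

open MeasureTheory Set Literature.Probability.LatticeModels Literature.Probability.Percolation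

noncomputable section
open Classical

variable {n : ℕ}

/-- Two-relay E-form (Kozma–Nitzan Theorem 1 with the single observer `o`): `μ((o↔a₁ ∪ o↔a₃) ∖ o↔b) ≤ max(μ(a₁↮b), μ(a₃↮b))`,
here under `μ(a₁↔b) = μ(a₃↔b)` in the form `≤ μ(a₃↮b)`. [cite: KozmaNitzan2024, Theorem 1 (§3.1, inequality (3))] -/
theorem additiveGluing_twoRelays_eform_tie (w : Sym2 (Fin n) → unitInterval) (o b a₁ a₃ : Fin n)
    (hτ31 : (prodBernoulli w).real (openConn a₃ b) ≤ (prodBernoulli w).real (openConn a₁ b)) :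
    (prodBernoulli w).real ((openConn o a₁ ∪ openConn o a₃) \ openConn o b : Set (BondConfig (Fin n))) ≤
      (prodBernoulli w).real ((openConn a₃ b)ᶜ : Set (BondConfig (Fin n))) := by
  have hm : ∀ s : Set (BondConfig (Fin n)), MeasurableSet s := fun _ => MeasurableSet.of_discrete
  have h := stub_knThm1Set n w {o} a₁ a₃ b
  have hE : (⋃ s ∈ ({o} : Finset (Fin n)), (openConn s a₁ ∪ openConn s a₃ : Set (BondConfig (Fin n)))) =
      openConn o a₁ ∪ openConn o a₃ := by
    ext ω; simp only [Set.mem_iUnion, Finset.mem_singleton, exists_prop, exists_eq_left]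
  have hB : (⋃ s ∈ ({o} : Finset (Fin n)), (openConn s b : Set (BondConfig (Fin n)))) = openConn o b := by
    ext ω; simp only [Set.mem_iUnion, Finset.mem_singleton, exists_prop, exists_eq_left]
  rw [hE, hB] at h
  set OW : Set (BondConfig (Fin n)) := openConn o a₁ ∪ openConn o a₃ with hOW
  have s1 := measureReal_inter_add_sdiff (μ := prodBernoulli w) (s := OW) (hm (openConn a₁ b))
  have s3 := measureReal_inter_add_sdiff (μ := prodBernoulli w) (s := OW) (hm (openConn a₃ b))
  have sb := measureReal_inter_add_sdiff (μ := prodBernoulli w) (s := OW) (hm (openConn o b))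
  have c1 : (prodBernoulli w).real ((openConn a₁ b)ᶜ : Set (BondConfig (Fin n))) =
      1 - (prodBernoulli w).real (openConn a₁ b : Set (BondConfig (Fin n))) := probReal_compl_eq_one_sub (hm _)
  have c3 : (prodBernoulli w).real ((openConn a₃ b)ᶜ : Set (BondConfig (Fin n))) =
      1 - (prodBernoulli w).real (openConn a₃ b : Set (BondConfig (Fin n))) := probReal_compl_eq_one_sub (hm _)
  have d1 : (prodBernoulli w).real (OW \ openConn a₁ b) ≤ (prodBernoulli w).real ((openConn a₁ b)ᶜ : Set (BondConfig (Fin n))) :=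
    measureReal_mono fun ω hω => hω.2
  have d3 : (prodBernoulli w).real (OW \ openConn a₃ b) ≤ (prodBernoulli w).real ((openConn a₃ b)ᶜ : Set (BondConfig (Fin n))) :=
    measureReal_mono fun ω hω => hω.2
  have hmin : (prodBernoulli w).real OW - (prodBernoulli w).real ((openConn a₃ b)ᶜ : Set (BondConfig (Fin n))) ≤
      min ((prodBernoulli w).real (OW ∩ openConn a₁ b)) ((prodBernoulli w).real (OW ∩ openConn a₃ b)) :=
    le_min (by linarith) (by linarith)
  linarith

/-- **Three relays on the tie locus from the glued-pair exchange (T-d).**  If (T-d) (`stub_gluedPairExchangeTie_pl`) holds on the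
bad tie region, then for three distinct relays with `τ₃ ≤ τ₁ ≤ τ₃`, `τ₃ ≤ τ₂` and `μ(aᵢ ↔ b) ≥ 1 − t`: `μ({o ↔ A} ∖ {o ↔ b}) ≤ t`.
Cases: `τ(o) ≥ τ₃` trivial; good region by `knThm2_core` (r2); bad region and `μ(N₂∩O₂) = 0` by the two-relay E-form
(`additiveGluing_twoRelays_eform_tie`); bad region and `μ(N₂∩O₂) > 0` by `additiveGluing_threeRelays_eform_of_gluedPairExchange`.
[cite: KozmaNitzan2024, Theorem 2 (§3.2, pp. 8–9)] -/
theorem additiveGluing_threeRelays_of_gluedPairExchange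
    (hTd : ∀ (n : ℕ) (w : Sym2 (Fin n) → unitInterval) (o b a₁ a₂ a₃ : Fin n), a₁ ≠ a₂ → a₁ ≠ a₃ → a₂ ≠ a₃ → (prodBernoulli w).real (openConn a₃ b) ≤ (prodBernoulli w).real (openConn a₁ b) → (prodBernoulli w).real (openConn a₃ b) ≤ (prodBernoulli w).real (openConn a₂ b) → (prodBernoulli w).real (openConn a₁ b) ≤ (prodBernoulli w).real (openConn a₃ b) → (prodBernoulli w).real (openConn o b) < (prodBernoulli w).real (openConn a₃ b) → (prodBernoulli w).real ((openConn a₁ a₃)ᶜ ∩ (openConn a₂ a₃)ᶜ ∩ (openConn a₁ b ∩ openConn a₂ b)) < (prodBernoulli w).real ((openConn a₁ a₃)ᶜ ∩ (openConn a₂ a₃)ᶜ ∩ openConn a₃ b) → ((prodBernoulli w).real ((openConn a₂ a₁)ᶜ ∩ (openConn a₂ a₃)ᶜ ∩ (openConn o a₁ ∪ openConn o a₃)) + (prodBernoulli w).real ((openConn a₂ a₁)ᶜ ∩ (openConn a₂ a₃)ᶜ ∩ openConn o a₂)) * (prodBernoulli w).real ((openConn o b)ᶜ ∩ (openConn o a₁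 ∩ openConn a₃ b ∪ openConn o a₃ ∩ openConn a₁ b)) ≤ (prodBernoulli w).real ((openConn a₂ a₁)ᶜ ∩ (openConn a₂ a₃)ᶜ ∩ (openConn o a₁ ∪ openConn o a₃)) * ((prodBernoulli w).real (openConn a₁ b ∩ (openConn a₃ b)ᶜ) + (prodBernoulli w).real ((openConn a₁ b)ᶜ ∩ (openConn a₃ b)ᶜ ∩ (openConn o a₁ ∪ openConn o a₂ ∪ openConn o a₃)ᶜ)) + (prodBernoulli w).real ((openConn a₂ a₁)ᶜ ∩ (openConn a₂ a₃)ᶜ ∩ openConn o a₂) * (((prodBernoulli w).real (openConn a₂ b) - (prodBernoulli w).real (openConn a₃ b)) + (prodBernoulli w).real ((openConn a₂ b)ᶜ ∩ (openConn a₂ a₁ ∩ openConn a₃ b ∪ openConn a₂ a₃ ∩ openConn a₁ b)) + (prodBernoulli w).real ((openConn a₂ b)ᶜ ∩ ((openConn a₂ a₁ ∪ openConn a₂ a₃) ∩ (openConn a₁ b ∪ openConn a₃ b))ᶜ ∩ (openConn o a₁ ∪ openConn o a₂ ∪ openConn o a₃)ᶜ))) :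
    ∀ (n : ℕ) (w : Sym2 (Fin n) → unitInterval) (o b a₁ a₂ a₃ : Fin n) (t : ℝ),
      a₁ ≠ a₂ → a₁ ≠ a₃ → a₂ ≠ a₃ →
      1 - t ≤ (prodBernoulli w).real (openConn a₃ b) →
      (prodBernoulli w).real (openConn a₃ b) ≤ (prodBernoulli w).real (openConn a₁ b) →
      (prodBernoulli w).real (openConn a₃ b) ≤ (prodBernoulli w).real (openConn a₂ b) →
      (prodBernoulli w).real (openConn a₁ b) ≤ (prodBernoulli w).real (openConn a₃ b) →
      (prodBernoulli w).real ((openConn o a₁ ∪ openConn o a₂ ∪ openConn o a₃) \ openConn o b) ≤ t := by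
  intro n w o b a₁ a₂ a₃ t h12 h13 h23 hτ3 hτ31 hτ32 htie
  have hm : ∀ s : Set (BondConfig (Fin n)), MeasurableSet s := fun _ => MeasurableSet.of_discrete
  have hc3 : (prodBernoulli w).real ((openConn a₃ b)ᶜ : Set (BondConfig (Fin n))) =
      1 - (prodBernoulli w).real (openConn a₃ b : Set (BondConfig (Fin n))) := probReal_compl_eq_one_sub (hm _)
  suffices hE : (prodBernoulli w).real ((openConn o a₁ ∪ openConn o a₂ ∪ openConn o a₃) \ openConn o b) ≤
      (prodBernoulli w).real ((openConn a₃ b)ᶜ : Set (BondConfig (Fin n))) by linarith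
  by_cases hob : (prodBernoulli w).real (openConn a₃ b) ≤ (prodBernoulli w).real (openConn o b)
  · have hco : (prodBernoulli w).real ((openConn o b)ᶜ : Set (BondConfig (Fin n))) =
        1 - (prodBernoulli w).real (openConn o b : Set (BondConfig (Fin n))) := probReal_compl_eq_one_sub (hm _)
    have hsub : (prodBernoulli w).real ((openConn o a₁ ∪ openConn o a₂ ∪ openConn o a₃) \ openConn o b) ≤
        (prodBernoulli w).real ((openConn o b)ᶜ : Set (BondConfig (Fin n))) :=
      measureReal_mono (fun ω hω => hω.2)
    linarith
  · push Not at hob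
    by_cases hgood : (prodBernoulli w).real (openConn b a₃ ∩ (openConn b a₁)ᶜ ∩ (openConn b a₂)ᶜ) ≤
        (prodBernoulli w).real (openConn b a₁ ∩ openConn b a₂ ∩ (openConn b a₃)ᶜ)
    · have hX := knThm2_core stub_bhkSets.1 stub_bhkSets.2 (stub_knLemma2 stub_bhkSets) w o b a₁ a₂ a₃
        h12 h13 h23 hτ31 hτ32 hgood
      have h1 := measureReal_inter_add_sdiff (μ := prodBernoulli w)
        (s := openConn o a₁ ∪ openConn o a₂ ∪ openConn o a₃) (hm (openConn o b))
      have h2 := measureReal_inter_add_sdiff (μ := prodBernoulli w)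
        (s := openConn o a₁ ∪ openConn o a₂ ∪ openConn o a₃) (hm (openConn a₃ b))
      have h3 : (prodBernoulli w).real ((openConn o a₁ ∪ openConn o a₂ ∪ openConn o a₃) \ openConn a₃ b) ≤
          (prodBernoulli w).real ((openConn a₃ b)ᶜ : Set (BondConfig (Fin n))) :=
        measureReal_mono fun ω hω => hω.2
      linarith
    · push Not at hgood
      rw [knThm2_m3, knThm2_m12] at hgood
      -- bad region: degenerate or not
      by_cases hβ0 : (prodBernoulli w).real ((openConn a₂ a₁)ᶜ ∩ (openConn a₂ a₃)ᶜ ∩ openConn o a₂ : Set (BondConfig (Fin n))) = 0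
      · -- `{o↔A} ∖ {o↔b} ⊆ (O_W ∖ o↔b) ∪ (N₂ ∩ O₂)`
        have hsub : ((openConn o a₁ ∪ openConn o a₂ ∪ openConn o a₃) \ openConn o b : Set (BondConfig (Fin n))) ⊆
            ((openConn o a₁ ∪ openConn o a₃) \ openConn o b) ∪ (openConn o a₂ ∩ (openConn o a₁ ∪ openConn o a₃)ᶜ) := by
          intro ω hω
          simp only [Set.mem_sdiff, Set.mem_union, Set.mem_inter_iff, Set.mem_compl_iff] at hω ⊢
          tauto
        rw [gluedPair_O2_diff_OW o a₁ a₂ a₃] at hsub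
        have h1 := (measureReal_mono (μ := prodBernoulli w) hsub).trans (measureReal_union_le _ _)
        have h2 := additiveGluing_twoRelays_eform_tie w o b a₁ a₃ hτ31
        linarith
      · have hnd : 0 < (prodBernoulli w).real ((openConn a₂ a₁)ᶜ ∩ (openConn a₂ a₃)ᶜ ∩ (openConn o a₁ ∪ openConn o a₃)) +
            (prodBernoulli w).real ((openConn a₂ a₁)ᶜ ∩ (openConn a₂ a₃)ᶜ ∩ openConn o a₂) := by
          have hα : 0 ≤ (prodBernoulli w).real ((openConn a₂ a₁)ᶜ ∩ (openConn a₂ a₃)ᶜ ∩ (openConn o a₁ ∪ openConn o a₃) :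
              Set (BondConfig (Fin n))) := measureReal_nonneg
          have hβ : 0 < (prodBernoulli w).real ((openConn a₂ a₁)ᶜ ∩ (openConn a₂ a₃)ᶜ ∩ openConn o a₂ : Set (BondConfig (Fin n))) :=
            lt_of_le_of_ne measureReal_nonneg (Ne.symm hβ0)
          linarith
        exact additiveGluing_threeRelays_eform_of_gluedPairExchange w o b a₁ a₂ a₃ h12 h23 hnd
          (hTd n w o b a₁ a₂ a₃ h12 h13 h23 hτ31 hτ32 htie hob hgood)

end

end Summit.CriticalPhenomena.PercolationContinuityZ3.Theorems
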